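import Literature.NumberTheory.EllipticCurves.CastellaGrossiLeeSkinner2022.HowardDivisibilityAnyClassNumber
import Literature.NumberTheory.EllipticCurves.HeegnerModuleScalingDivisibilityProofs
import Literature.NumberTheory.EllipticCurves.BurungaleKobayashiNakamuraOta2026.PadicEndSpan
import HarnessLib

/-!
# The Heegner-module envelope, LEVELWISE ⟹ Λ-ADIC: `(p^e)·ℋ̄_k(F) ⊆ ℤ_p[Gal(K_k/K)]·κ_k(C)` for `k > δ`
# gives `(p^e)·ℋ_∞(F) ⊆ Λκ_∞(C)` (bookkeeping for CGLS 2022 Rem. 4.1.4 / Perrin-Riou 1987 §3.4; proofs file)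

Topic `NumberTheory/EllipticCurves`. THEOREMS ONLY (no definition, no named fact, no `sorry`) on the
vocabulary of `HeegnerModuleIndex.lean` (`heegnerModuleLayer`, `heegnerModule`, `conjPi`, `padicPi`) and
`CastellaGrossiLeeSkinner2022/HowardDivisibilityAnyClassNumber.lean` (`stabilizedClassLayer`,
`stabilizedModuleLayer`, `stabilizedHeegnerModule`). Written by the cell `bsd-print-x9` seat `bsd-line-x9-p2`
(crux stmt-BirchSwinnertonDyer-26359 `PrintX9.HowardContainmentLightFramePinnedOfPrint`, stub `stub_envelopeTied`;
its aside twin 25235) as the KUMMER/Λ-ADIC HALF of the envelope comparison `ℋ_∞(F) ~ Λκ_∞(C)` between the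
tree's Heegner module and CGLS's `d(k)`-shifted stabilised module — the half that is pure bookkeeping: the
`ℤ_p[Gal(K_k/K)]`-stability of the level modules and the passage from the levels `k > δ` to the `Λ`-adic
modules through `LambdaAdicSelmerData.proj_C`. The GEOMETRIC half — a COHERENT system of Heegner points with
the vertical distribution relations (`HeegnerGeomGaloisTransferProofs`, `HeegnerGeomPrincipalSystemProofs`,
seat x9-p1) and the resulting `κ`-line membership of (a `p`-power multiple of) the Kummer families of
`y_K, z_0, …, z_k` — is the INPUT `hgen` of §3 and is not proved here.

WHAT.
* §1 `conjPi_mul`, `conjPi_padicPi_comm` — `conj_{στ} = conj_σ ∘ conj_τ` and `conj_σ (c·y) = c·conj_σ y` on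
  `∏_m H¹(K_k, E[p^m])` (from the generic `conjH1_mul_holds` and additivity).
* §2 `padicPi_mem_stabilizedModuleLayer`, `conjPi_pow_mem_stabilizedModuleLayer`, `zsmul_mem_stabilizedModuleLayer`
  — `ℤ_p[Gal(K_k/K)]·κ_k` is stable under `c ·` (`c ∈ ℤ_p`), `conj_{γ^j}` and `n ·` (`n ∈ ℤ`).
* §3 `zsmul_mem_stabilizedModuleLayer_of_generators` — if `(p^e)·d ∈ ℤ_p[G_k]·κ_k` for every Kummer family
  `d` of every generator `w ∈ {y_K, z_0, …, z_k}` then `(p^e)·ℋ̄_k(F) ⊆ ℤ_p[G_k]·κ_k`.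
* §4 `pow_smul_mem_stabilizedHeegnerModule_of_levelwise`, `pow_smul_heegnerModule_le_stabilizedHeegnerModule_of_levelwise`
  — LEVELWISE ⟹ Λ-ADIC: if `(p^e)·ℋ̄_k(F) ⊆ ℤ_p[G_k]·κ_k(C)` for every `k > δ` then
  `(p^e) • ℋ_∞(F) ≤ Λκ_∞(C)` (`proj_k ((C p^e)•s) = p^e • proj_k s`, `proj_C_intCast_smul`; span induction);
  the layers `k ≤ δ` impose no condition (design of `stabilizedHeegnerModule`).
HONEST FRAMING: module bookkeeping only; nothing about any particular curve; BSD is not proved by any of this.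

References: [CastellaGrossiLeeSkinner2022] Rem. 4.1.4 («κ_∞ and κ₁^{Hg} generate the same Λ-submodule»),
Thm. 4.1.1 proof (`P_k[n]`, `d(k)`); [PerrinRiou1987BSMF] §3.4 (`ℋ_n`, `ℋ_∞`), §0 (`S_p`, `𝔖_p` as
`ℤ_p⟦Γ⟧`-modules); [Howard2004HeegnerKolyvagin] §3.3 (`H_k = ℤ_p[Gal(K_k/K)]·{…}`, `𝐇 = lim← H_k`).
-/

set_option autoImplicit false

noncomputable section

open scoped Classical Pointwise

open WeierstrassCurve Literature.NumberTheory.EllipticCurves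
  Literature.NumberTheory.EllipticCurves.CastellaGrossiLeeSkinner2022

universe u

namespace Literature.NumberTheory.EllipticCurves

/-! ## §1 `conjPi` is multiplicative and commutes with `padicPi` -/

section ConjPi

variable {K : Type u} [Field K] (W : WeierstrassCurve K) (p : ℕ) [Fact p.Prime]
  (H : Subgroup (Field.absoluteGaloisGroup K)) [H.Normal]

omit [Fact p.Prime] in
/-- `conj_{στ} = conj_σ ∘ conj_τ` on `∏_m H¹(H, E[p^m])` (componentwise `conjH1_mul_holds`).
[cite: SerreGaloisCohomology1997, I §2.5 (conjugation on H¹(H, M))] -/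
theorem conjPi_mul (σ τ : Field.absoluteGaloisGroup K) (y : W.torsionH1Pi p H) :
    W.conjPi p H (σ * τ) y = W.conjPi p H σ (W.conjPi p H τ y) := by
  funext m
  simp only [conjPi, AddMonoidHom.pi_apply, AddMonoidHom.coe_comp, Function.comp_apply,
    Pi.evalAddMonoidHom_apply]
  rw [conjH1_mul_holds H (geomTorsion W ((p : ℤ) ^ m)) σ τ, AddMonoidHom.comp_apply]

omit [Fact p.Prime] in
/-- Iterates: `conj_{σ^(i+j)} y = conj_{σ^i} (conj_{σ^j} y)`. [cite: SerreGaloisCohomology1997, I §2.5 (conjugation on H¹(H, M))] -/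
theorem conjPi_pow_add (σ : Field.absoluteGaloisGroup K) (i j : ℕ) (y : W.torsionH1Pi p H) :
    W.conjPi p H (σ ^ (i + j)) y = W.conjPi p H (σ ^ i) (W.conjPi p H (σ ^ j) y) := by
  rw [pow_add, conjPi_mul]

/-- `conj_σ (c · y) = c · conj_σ y` (`c ∈ ℤ_p` acts levelwise by integers; `conj_σ` is additive).
[cite: PerrinRiou1987BSMF, §0 pp. 401–402 (S_p(L) as a ℤ_p[Gal]-module)] -/
theorem conjPi_padicPi_comm (σ : Field.absoluteGaloisGroup K) (c : ℤ_[p]) (y : W.torsionH1Pi p H) :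
    W.conjPi p H σ (W.padicPi p H c y) = W.padicPi p H c (W.conjPi p H σ y) := by
  funext m
  simp only [conjPi, padicPi, AddMonoidHom.pi_apply, AddMonoidHom.coe_comp, Function.comp_apply,
    Pi.evalAddMonoidHom_apply, zsmulAddGroupHom_apply, map_zsmul]

end ConjPi

/-! ## §2 `ℤ_p[Gal(K_k/K)]·κ_k` is a `ℤ_p[Gal(K_k/K)]`-module -/

section StabilizedLayer

variable {N : ℕ} [NeZero N] {W : WeierstrassCurve ℚ} [W.IsGloballyMinimal] {K : Type u} [Field K]
  [NumberField K] {p : ℕ} [Fact p.Prime] {κ : ZpExtension K p} (γ : Field.absoluteGaloisGroup K)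
  {jbar : AlgebraicClosure K →+* ℂ} (C : StabilizedHeegnerData N W K κ jbar) (k : ℕ) (hk : C.depth < k)

/-- `ℤ_p[Gal(K_k/K)]·κ_k` is stable under `c ·`, `c ∈ ℤ_p` (`c·(c'·conj x) = (cc')·conj x` on generators,
`padicPi_padicPi`; `padicPi c` is additive). [cite: CastellaGrossiLeeSkinner2022, Rem. 4.1.4 (the module Λκ_∞ of the stabilised classes κ_k)] -/
theorem padicPi_mem_stabilizedModuleLayer (c : ℤ_[p])
    {y : (W.baseChange K).torsionH1Pi p (κ.layerSubgroup k)} (hy : y ∈ stabilizedModuleLayer γ C k hk) :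
    (W.baseChange K).padicPi p (κ.layerSubgroup k) c y ∈ stabilizedModuleLayer γ C k hk := by
  unfold stabilizedModuleLayer at hy ⊢
  induction hy using AddSubgroup.closure_induction with
  | mem z hz =>
    obtain ⟨c', i, x, hx, rfl⟩ := hz
    refine AddSubgroup.subset_closure ⟨c * c', i, x, hx, ?_⟩
    rw [padicPi_padicPi]
  | zero => rw [map_zero]; exact AddSubgroup.zero_mem _
  | add a b _ _ ha hb => rw [map_add]; exact AddSubgroup.add_mem _ ha hb
  | neg a _ ha => rw [map_neg]; exact AddSubgroup.neg_mem _ ha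

/-- `ℤ_p[Gal(K_k/K)]·κ_k` is stable under `n ·`, `n ∈ ℤ` (`n · = (n : ℤ_p) ·`, `padicPi_intCast`).
[cite: CastellaGrossiLeeSkinner2022, Rem. 4.1.4 (the module Λκ_∞)] -/
theorem zsmul_mem_stabilizedModuleLayer (n : ℤ)
    {y : (W.baseChange K).torsionH1Pi p (κ.layerSubgroup k)} (hy : y ∈ stabilizedModuleLayer γ C k hk) :
    n • y ∈ stabilizedModuleLayer γ C k hk := by
  rw [← padicPi_intCast]
  exact padicPi_mem_stabilizedModuleLayer γ C k hk _ hy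

/-- `ℤ_p[Gal(K_k/K)]·κ_k` is stable under `conj_{γ^j}` (`conj_{γ^j}(c·conj_{γ^i} x) = c·conj_{γ^{j+i}} x`).
[cite: CastellaGrossiLeeSkinner2022, Rem. 4.1.4 (the module Λκ_∞)] -/
theorem conjPi_pow_mem_stabilizedModuleLayer (j : ℕ)
    {y : (W.baseChange K).torsionH1Pi p (κ.layerSubgroup k)} (hy : y ∈ stabilizedModuleLayer γ C k hk) :
    (W.baseChange K).conjPi p (κ.layerSubgroup k) (γ ^ j) y ∈ stabilizedModuleLayer γ C k hk := by
  unfold stabilizedModuleLayer at hy ⊢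
  induction hy using AddSubgroup.closure_induction with
  | mem z hz =>
    obtain ⟨c, i, x, hx, rfl⟩ := hz
    refine AddSubgroup.subset_closure ⟨c, j + i, x, hx, ?_⟩
    rw [conjPi_padicPi_comm, conjPi_pow_add]
  | zero => rw [map_zero]; exact AddSubgroup.zero_mem _
  | add a b _ _ ha hb => rw [map_add]; exact AddSubgroup.add_mem _ ha hb
  | neg a _ ha => rw [map_neg]; exact AddSubgroup.neg_mem _ ha

end StabilizedLayer

/-! ## §3 From the generators `y_K, z_0, …, z_k` to the whole level module `ℋ̄_k(F)` -/

section Generators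

variable {N : ℕ} [NeZero N] {W : WeierstrassCurve ℚ} [W.IsGloballyMinimal] {K : Type u} [Field K]
  [NumberField K] {p : ℕ} [Fact p.Prime] {κ : ZpExtension K p} (γ : Field.absoluteGaloisGroup K)
  {jbar : AlgebraicClosure K →+* ℂ} (F : HeegnerFamily N W K κ jbar)
  (C : StabilizedHeegnerData N W K κ jbar) (k : ℕ) (hk : C.depth < k)

/-- **Generators suffice**: if a `p`-power (any integer `n`) multiple of every Kummer family `d` of every
generator `w ∈ {y_K, z_0, …, z_k}` of the level module lies in `ℤ_p[Gal(K_k/K)]·κ_k`, then so does `n · x` for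
every `x ∈ ℋ̄_k(F)` — `ℋ̄_k(F)` is generated by the `c·conj_{γ^i} d` and `ℤ_p[G_k]·κ_k` is `ℤ_p[G_k]`-stable (§2).
[cite: Howard2004HeegnerKolyvagin, §3.3 (H_k = ℤ_p[Gal(K_k/K)]·{y_K, z_0, …, z_k})] [cite: CastellaGrossiLeeSkinner2022, Rem. 4.1.4] -/
theorem zsmul_mem_stabilizedModuleLayer_of_generators (n : ℤ)
    (hgen : ∀ (w : geomPoints (W.baseChange K)) (hw : w ∈ F.generators k)
      (d : (W.baseChange K).torsionH1Pi p (κ.layerSubgroup k)),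
      (∀ (m : ℕ) (Q : geomPoints (W.baseChange K)) (hQ : ((p : ℤ) ^ m) • Q = w),
        d m = (W.baseChange K).kummerClassOver (κ.layerSubgroup k) ((p : ℤ) ^ m) Q
          (fun σ hσ ↦ by rw [hQ]; exact F.smul_eq_of_mem_generators hw hσ)) →
      n • d ∈ stabilizedModuleLayer γ C k hk)
    {x : (W.baseChange K).torsionH1Pi p (κ.layerSubgroup k)} (hx : x ∈ heegnerModuleLayer γ F k) :
    n • x ∈ stabilizedModuleLayer γ C k hk := by
  unfold heegnerModuleLayer at hx
  induction hx using AddSubgroup.closure_induction with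
  | mem v hv =>
    obtain ⟨c, i, w, hw, d, hd, rfl⟩ := hv
    rw [← map_zsmul, ← map_zsmul]
    exact padicPi_mem_stabilizedModuleLayer γ C k hk c
      (conjPi_pow_mem_stabilizedModuleLayer γ C k hk i (hgen w hw d hd))
  | zero => rw [zsmul_zero]; exact AddSubgroup.zero_mem _
  | add a b _ _ ha hb => rw [zsmul_add]; exact AddSubgroup.add_mem _ ha hb
  | neg a _ ha => rw [zsmul_neg]; exact AddSubgroup.neg_mem _ ha

end Generators

/-! ## §4 LEVELWISE ⟹ Λ-ADIC -/

section LambdaAdic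

variable {N : ℕ} [NeZero N] {W : WeierstrassCurve ℚ} [W.IsGloballyMinimal] {K : Type u} [Field K]
  [NumberField K] {p : ℕ} [Fact p.Prime] {κ : ZpExtension K p} {γ : Field.absoluteGaloisGroup K}
  {jbar : AlgebraicClosure K →+* ℂ} (D : (W.baseChange K).LambdaAdicSelmerData κ γ)
  (F : HeegnerFamily N W K κ jbar) (C : StabilizedHeegnerData N W K κ jbar) (e : ℕ)

/-- **LEVELWISE ⟹ Λ-ADIC, elementwise**: if `(p^e)·ℋ̄_k(F) ⊆ ℤ_p[Gal(K_k/K)]·κ_k(C)` at every layer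
`k > δ`, then `(p^e) • s ∈ Λκ_∞(C)` for every `s ∈ ℋ_∞(F)` — for a spanning `s` (all projections in the
`ℋ̄_k`), `proj_k ((C p^e)•s) = p^e • proj_k s` (`proj_C_intCast_smul`) lies in `ℤ_p[G_k]·κ_k` for `k > δ`,
which is the membership test of `stabilizedHeegnerModule` (layers `k ≤ δ` impose nothing); then span
induction. [cite: CastellaGrossiLeeSkinner2022, Rem. 4.1.4 (κ_∞ = lim← δ(κ_k); «generate the same Λ-submodule»)]
[cite: PerrinRiou1987BSMF, §3.4 (ℋ_∞ = lim← ℋ_n)] -/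
theorem pow_smul_mem_stabilizedHeegnerModule_of_levelwise
    (hlev : ∀ (k : ℕ) (hk : C.depth < k), ∀ x ∈ heegnerModuleLayer γ F k,
      ((p : ℤ) ^ e) • x ∈ stabilizedModuleLayer γ C k hk)
    {s : D.S} (hs : s ∈ heegnerModule D F) :
    ((p : IwasawaAlgebra p) ^ e) • s ∈ stabilizedHeegnerModule D C := by
  have hC : ((p : IwasawaAlgebra p) ^ e) = (PowerSeries.C ((((p : ℤ) ^ e : ℤ)) : ℤ_[p]) : IwasawaAlgebra p) := by
    rw [Int.cast_pow, Int.cast_natCast, map_pow, map_natCast]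
  unfold heegnerModule at hs
  induction hs using Submodule.span_induction with
  | mem g hg =>
    refine mem_stabilizedHeegnerModule_of_proj_mem D C fun k hk ↦ ?_
    rw [hC, D.proj_C_intCast_smul]
    exact hlev k hk _ (hg k)
  | zero => rw [smul_zero]; exact Submodule.zero_mem _
  | add a b _ _ ha hb => rw [smul_add]; exact Submodule.add_mem _ ha hb
  | smul r a _ ha => rw [smul_comm]; exact Submodule.smul_mem _ r ha

/-- **LEVELWISE ⟹ Λ-ADIC, submodule form**: `(p^e) • ℋ_∞(F) ≤ Λκ_∞(C)` — the shape consumed by the scaling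
reduction (`heegnerCharIdeal_le_span_pow_mul_stabilizedHeegnerCharIdeal_of_le_smul`, with the exponent moved to
the rescaled family). [cite: CastellaGrossiLeeSkinner2022, Rem. 4.1.4] [cite: PerrinRiou1987BSMF, §3.4] -/
theorem pow_smul_heegnerModule_le_stabilizedHeegnerModule_of_levelwise
    (hlev : ∀ (k : ℕ) (hk : C.depth < k), ∀ x ∈ heegnerModuleLayer γ F k,
      ((p : ℤ) ^ e) • x ∈ stabilizedModuleLayer γ C k hk) :
    ((p : IwasawaAlgebra p) ^ e) • heegnerModule D F ≤ stabilizedHeegnerModule D C := by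
  intro s hs
  obtain ⟨t, ht, rfl⟩ := (Submodule.mem_smul_pointwise_iff_exists _ _ _).mp hs
  exact pow_smul_mem_stabilizedHeegnerModule_of_levelwise D F C e hlev ht

/-- **Generators, levelwise ⟹ Λ-adic** (§3 + §4): the envelope `(p^e) • ℋ_∞(F) ≤ Λκ_∞(C)` follows from the
`κ`-line membership of `(p^e)·d` for the Kummer families `d` of the generators `y_K, z_0, …, z_k` at every layer
`k > δ` — the exact hand-over point to the geometric half (coherent Heegner points + vertical distribution
relations). [cite: CastellaGrossiLeeSkinner2022, Rem. 4.1.4] [cite: Howard2004HeegnerKolyvagin, §3.3] -/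
theorem pow_smul_heegnerModule_le_stabilizedHeegnerModule_of_generators
    (hgen : ∀ (k : ℕ) (hk : C.depth < k) (w : geomPoints (W.baseChange K)) (hw : w ∈ F.generators k)
      (d : (W.baseChange K).torsionH1Pi p (κ.layerSubgroup k)),
      (∀ (m : ℕ) (Q : geomPoints (W.baseChange K)) (hQ : ((p : ℤ) ^ m) • Q = w),
        d m = (W.baseChange K).kummerClassOver (κ.layerSubgroup k) ((p : ℤ) ^ m) Q
          (fun σ hσ ↦ by rw [hQ]; exact F.smul_eq_of_mem_generators hw hσ)) →
      ((p : ℤ) ^ e) • d ∈ stabilizedModuleLayer γ C k hk) :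
    ((p : IwasawaAlgebra p) ^ e) • heegnerModule D F ≤ stabilizedHeegnerModule D C :=
  pow_smul_heegnerModule_le_stabilizedHeegnerModule_of_levelwise D F C e fun k hk _ hx ↦
    zsmul_mem_stabilizedModuleLayer_of_generators γ F C k hk _ (hgen k hk) hx

end LambdaAdic

end Literature.NumberTheory.EllipticCurves

end
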